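/-
Copyright (c) 2026 the pub-hodgecm-mathlib formalisation cell (harness21).  Prover seat hodgecm-mathlib-A-p06 (g29) — (U) road, U4-DISCHARGE brick (b3)-(ii), FILE 3 «the LOCAL any-window identity
(CM slice) and the total mass of μ^TF_w» (LEAD F0P3a-plan (g10) WORDS T9-40 (d1) ∕ T9-41 (3); owner A-p19 (g24); split with A-p12 (g20) and F0P3-p03 (g11) 13:31Z).
-/
import Literature.NumberTheory.Weil1964.UnitaryArchTopFormHaarProductPlacesCM   -- ★ U2 HEAD (A-p06 g28): `map_archPiEquiv_archTopFormHaar` (+ FILE F, FILE E, FILE D, ★ (P0))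
import Literature.NumberTheory.Weil1964.UnitaryArchLocalCayleyExhaustion        -- FILE 2 (A-p06 g29): `measure_univ_eq_lintegral_cayleyWeightC_of_window`
import HarnessLib

/-!
# The LOCAL any-window identity `μ^TF_w|_{ĉ_w(V)} = ĉ_{w*}(w₀,w · λ_w|_V)` for the factor `U(σ_w H)(ℂ)` of a CM unitary group, by SLICING the global one, and the total mass
# `μ^TF_w(U(σ_w H)(ℂ)) = ∫_{𝔲(σ_w H)} w₀,w dλ_w` ((U) road, U4-DISCHARGE brick (b3)-(ii), FILE 3; Helgason 2000 Ch. I §1 Thm. 1.14; Rogawski 1990 §1.7)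

Topic `NumberTheory/Weil1964`, namespaces `Literature.NumberTheory.Weil1964.UnitaryArchTopForm` (generic `F, E, c, J` section, as ★ U2 FILE F) and
`Literature.NumberTheory.Weil1964.UnitaryArchLocalTopForm` (CM reading).  THEOREMS ONLY (no definition, no instance, no notation, no named fact, no `sorry`).
Cell `pub/hodgecm-mathlib`, crux H413 = `stmt-HodgeConjecture-24833` (supports only).  Consumers: A-p12 (g20) (b3)-(iii) (the VALUES `vol^TF(U(1)) = π`, `vol^TF(U(2))`),
F0P3-p03 (g11) (d2)(e) (congruence transport of `∫ w₀ dλ`), hence the in-house discharge of ★ U4 `ArchTopFormWallCompatible` (cpt).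
HONEST LABEL: HC_CM is proved only modulo the 2 remaining named inputs (hLiu418 24832, h413 24833) until rung 0 closes; nothing printed is discharged here.

WHY SLICING (design B′ of ★ U1; owner's note «do NOT re-run ★ B5b locally»): ★ U1 FILE B DEFINES `localTopFormHaar N Jw` by its window value only; the Jacobian
cocycle making `ĉ_*(w₀ · λ)` locally left-invariant exists in the tree only GLOBALLY (★ B5b, ★ (P0)).  For `Jw = σ_w J`, `J` `c`-hermitian non-degenerate over a CM-type
extension, the local identity follows from the global one through the PRODUCT THEOREM ★ U2 `map_archPiEquiv_archTopFormHaar`: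
* §1 `lintegral_cayleyWeight_preimage_pi` — Fubini for the chart measure of a product set `skewPiEquiv⁻¹(Π_w A_w)` with MEASURABLE `A_w` on which `w₀,w` is integrable
  (★ FILE F `lintegral_cayleyWeight_preimage_pi_windowC` with the windows replaced by `A_w`); `archTopFormHaar_restrict_image_preimage_pi` — ★ (P0) on an admissible
  PRODUCT window `Π_w V_w`.
* §2 `localTopFormHaar_restrict_image_of_isOpen_of` — THE SLICE: for admissible `V` at `w₀` and measurable `S`, evaluate `⊗_w μ^TF_w = (archPiEquiv)_* μ^TF` on the box
  `ĉ_{w₀}(ĉ_{w₀}⁻¹ S ∩ V) × Π_{w ≠ w₀} ĉ_w(W_w)` in two ways (`Measure.pi_pi` ∕ ★ (P0) on the product window `V × Π W_w` + Fubini) and cancel the finite non-zero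
  other-place window masses; `localTopFormHaar_restrict_image_of_isOpen` discharges `hlam`∕`hweight`∕`hnd` from `(J.map c)ᵀ = J`, `IsUnit J.det` (★ FILE E, ★ `lieGramDet_ne_zero`).
* §3 CM reading: **`archLocalTopFormHaar_restrict_image_of_isOpen (L N H) (hherm hdet) (w) {V K} …`** and, with FILE 2's exhaustion + FILE 1's null complement,
  **`archLocalTopFormHaar_univ_eq_lintegral : μ^TF_w(univ) = ∫⁻ X, ofReal (w₀,w X) ∂λ_w`** (+ the `∫⁻` over `cayleySourceC` twin).

## References
* S. Helgason, *Groups and Geometric Analysis*, AMS Math. Surveys Monogr. 83 (2000), Ch. I §1 Thm. 1.14 (13) p. 96. [Helgason2000]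
* J. D. Rogawski, *Automorphic Representations of Unitary Groups in Three Variables*, Ann. of Math. Stud. 123 (1990), §1.7 p. 6 («`dg = Π_v dg_v`, `dg_v = |Ω|_v`»). [Rogawski1990]
-/

set_option autoImplicit false
-- submodule-normed vs subtype topologies on `↥(skewC …)` ∕ `↥(archSkew …)` (as in ★ FILE B ∕ ★ FILE F ∕ ★ `UnitaryArchTopFormHaar`)
set_option backward.isDefEq.respectTransparency false

noncomputable section

open Set MeasureTheory MeasureTheory.Measure NumberField NumberField.InfinitePlace NumberField.mixedEmbedding Literature.Analysis.Calculus
open scoped Classical Matrix Matrix.Norms.Operator MatrixGroups ENNReal NNReal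

namespace Literature.NumberTheory.Weil1964

namespace UnitaryArchTopForm

open Literature.NumberTheory.Automorphic Literature.NumberTheory.Automorphic.UnitaryGroup Literature.NumberTheory.Weil1964.UnitaryArchLocalTopForm

section Generic

variable (F E : Type) [Field F] [Field E] [NumberField E] [Algebra F E] (c : E ≃ₐ[F] E) (N : ℕ) (J : Matrix (Fin N) (Fin N) E)

variable {F E c N J}

variable [MeasurableSpace (archSkew F E c N J)] [BorelSpace (archSkew F E c N J)] [MeasurableSpace (arch F E c N J)] [BorelSpace (arch F E c N J)]
  [MeasurableSpace (GL (Fin N) ℂ)] [BorelSpace (GL (Fin N) ℂ)]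
  [∀ w : {w : InfinitePlace E // IsComplex w}, MeasurableSpace ↥(skewC N (J.map w.1.embedding))]
  [∀ w : {w : InfinitePlace E // IsComplex w}, BorelSpace ↥(skewC N (J.map w.1.embedding))]

/-! ## §1 Fubini on a product of measurable sets, and ★ (P0) on an admissible product window -/

omit [NumberField E] [MeasurableSpace ↥(archSkew F E c N J)] [BorelSpace ↥(archSkew F E c N J)] [MeasurableSpace ↥(arch F E c N J)]
  [BorelSpace ↥(arch F E c N J)] [MeasurableSpace (GL (Fin N) ℂ)] [BorelSpace (GL (Fin N) ℂ)] in
/-- The one-place weight is integrable on any subset of a compact subset of the one-place source, against any measure finite on compacts. [cite: Helgason2000, Ch. I §1 Thm. 1.14 p. 96] -/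
theorem integrableOn_cayleyWeightC_of_subset_isCompact (w : {w : InfinitePlace E // IsComplex w}) (lam : Measure ↥(skewC N (J.map w.1.embedding)))
    [IsFiniteMeasureOnCompacts lam] {A K : Set ↥(skewC N (J.map w.1.embedding))} (hK : IsCompact K) (hKs : K ⊆ cayleySourceC N (J.map w.1.embedding)) (hAK : A ⊆ K) :
    IntegrableOn (cayleyWeightC N (J.map w.1.embedding)) A lam :=
  ((continuousOn_cayleyWeightC.mono hKs).integrableOn_compact hK).mono_set hAK

omit [MeasurableSpace ↥(arch F E c N J)] [BorelSpace ↥(arch F E c N J)] [MeasurableSpace (GL (Fin N) ℂ)] [BorelSpace (GL (Fin N) ℂ)] in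
/-- **Fubini for the chart measure of a product of MEASURABLE sets**: `∫_{skewPiEquiv⁻¹(Π_w A_w)} w₀ dλ = Π_w ∫_{A_w} w₀,w dλ_w`, given (E1) `hlam`, (E2) `hweight` and
integrability of `w₀,w` on `A_w` (★ FILE F `lintegral_cayleyWeight_preimage_pi_windowC` with the windows replaced by the `A_w`). [cite: Helgason2000, Ch. I §1 Thm. 1.14 p. 96] [cite: Rogawski1990, §1.7 p. 6] -/
theorem lintegral_cayleyWeight_preimage_pi (hc : c ≠ 1) (hfix : ∀ w : InfinitePlace E, c • w = w)
    (hndw : ∀ w : {w : InfinitePlace E // IsComplex w}, lieGramDetC N (J.map w.1.embedding) ≠ 0)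
    (hlam : (lieStdLebesgue F E c N J).map (skewPiEquiv F E c N J hc hfix) =
      Measure.pi fun w : {w : InfinitePlace E // IsComplex w} => lieStdLebesgueC N (J.map w.1.embedding))
    (hweight : ∀ X : archSkew F E c N J,
      cayleyWeight F E c N J X = ∏ w : {w : InfinitePlace E // IsComplex w}, cayleyWeightC N (J.map w.1.embedding) (skewPiEquiv F E c N J hc hfix X w))
    (A : ∀ w : {w : InfinitePlace E // IsComplex w}, Set ↥(skewC N (J.map w.1.embedding)))
    (hAi : ∀ w : {w : InfinitePlace E // IsComplex w}, IntegrableOn (cayleyWeightC N (J.map w.1.embedding)) (A w) (lieStdLebesgueC N (J.map w.1.embedding))) :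
    ∫⁻ X in skewPiEquiv F E c N J hc hfix ⁻¹' Set.pi Set.univ A, ENNReal.ofReal (cayleyWeight F E c N J X) ∂lieStdLebesgue F E c N J =
      ∏ w : {w : InfinitePlace E // IsComplex w}, ∫⁻ X in A w, ENNReal.ofReal (cayleyWeightC N (J.map w.1.embedding) X) ∂lieStdLebesgueC N (J.map w.1.embedding) := by
  haveI : ∀ w : {w : InfinitePlace E // IsComplex w}, (lieStdLebesgueC N (J.map w.1.embedding)).IsAddHaarMeasure := fun w =>
    isAddHaarMeasure_lieStdLebesgueC (hndw w)
  haveI : ∀ w : {w : InfinitePlace E // IsComplex w}, SigmaFinite (lieStdLebesgueC N (J.map w.1.embedding)) := fun w => by infer_instance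
  haveI : BorelSpace (∀ w : {w : InfinitePlace E // IsComplex w}, ↥(skewC N (J.map w.1.embedding))) := Pi.borelSpace
  -- an opaque measurable equivalence with the same underlying map (keeps `whnf` cheap; ★ FILE F)
  obtain ⟨eM, heMc⟩ : ∃ eM : ↥(archSkew F E c N J) ≃ᵐ (∀ w : {w : InfinitePlace E // IsComplex w}, ↥(skewC N (J.map w.1.embedding))),
      ⇑eM = ⇑(skewPiEquiv F E c N J hc hfix) :=
    ⟨(skewPiEquiv F E c N J hc hfix).toHomeomorph.toMeasurableEquiv, by
      rw [Homeomorph.toMeasurableEquiv_coe, ContinuousLinearEquiv.coe_toHomeomorph]⟩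
  have heMs : ∀ Y, skewPiEquiv F E c N J hc hfix (eM.symm Y) = Y := fun Y => by
    have h := eM.apply_symm_apply Y
    rwa [heMc] at h
  have hlam' : lieStdLebesgue F E c N J =
      (Measure.pi fun w : {w : InfinitePlace E // IsComplex w} => lieStdLebesgueC N (J.map w.1.embedding)).map eM.symm := by
    rw [← hlam, ← heMc, MeasurableEquiv.map_symm_map]
  have hpre : eM.symm ⁻¹' (skewPiEquiv F E c N J hc hfix ⁻¹' Set.pi Set.univ A) = Set.pi Set.univ A := by
    ext Y
    rw [Set.mem_preimage, Set.mem_preimage, heMs]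
  rw [hlam', MeasurableEquiv.restrict_map, lintegral_map_equiv, hpre, Measure.restrict_pi_pi]
  refine (lintegral_congr fun Y => ?_).trans
    (lintegral_pi_prod_ofReal (f := fun (w : {w : InfinitePlace E // IsComplex w}) (X : ↥(skewC N (J.map w.1.embedding))) =>
        cayleyWeightC N (J.map w.1.embedding) X) _ (fun w => hAi w) fun w X => cayleyWeightC_nonneg X)
  rw [hweight, ENNReal.ofReal_prod_of_nonneg fun w _ => cayleyWeightC_nonneg _]
  exact Finset.prod_congr rfl fun w _ => by rw [heMs]

omit [MeasurableSpace (GL (Fin N) ℂ)] [BorelSpace (GL (Fin N) ℂ)] [∀ w : {w : InfinitePlace E // IsComplex w}, MeasurableSpace ↥(skewC N (J.map w.1.embedding))]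
  [∀ w : {w : InfinitePlace E // IsComplex w}, BorelSpace ↥(skewC N (J.map w.1.embedding))] in
/-- **★ (P0) ON AN ADMISSIBLE PRODUCT WINDOW**: for one-place sets `V_w` open, `∋ 0`, inside compacts `K_w ⊆ source_w`, the product set `𝒱 = skewPiEquiv⁻¹(Π_w V_w)` is admissible and
`μ^TF|_{ĉ(𝒱)} = ĉ_*(w₀ · λ|_𝒱)`. [cite: Helgason2000, Ch. I §1 Thm. 1.14 (13) p. 96] -/
theorem archTopFormHaar_restrict_image_preimage_pi (hc : c ≠ 1) (hfix : ∀ w : InfinitePlace E, c • w = w) (hnd : lieGramDet F E c N J ≠ 0)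
    (V K : ∀ w : {w : InfinitePlace E // IsComplex w}, Set ↥(skewC N (J.map w.1.embedding)))
    (hVo : ∀ w : {w : InfinitePlace E // IsComplex w}, IsOpen (V w)) (hV0 : ∀ w : {w : InfinitePlace E // IsComplex w}, (0 : ↥(skewC N (J.map w.1.embedding))) ∈ V w) (hK : ∀ w : {w : InfinitePlace E // IsComplex w}, IsCompact (K w))
    (hKs : ∀ w : {w : InfinitePlace E // IsComplex w}, K w ⊆ cayleySourceC N (J.map w.1.embedding)) (hVK : ∀ w : {w : InfinitePlace E // IsComplex w}, V w ⊆ K w) :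
    (archTopFormHaar F E c N J).restrict (cayleyChart F E c N J '' (skewPiEquiv F E c N J hc hfix ⁻¹' Set.pi Set.univ V)) =
      cayleyChartMeasure F E c N J (lieStdLebesgue F E c N J) (skewPiEquiv F E c N J hc hfix ⁻¹' Set.pi Set.univ V) := by
  have hVo' : IsOpen (skewPiEquiv F E c N J hc hfix ⁻¹' Set.pi Set.univ V) :=
    (isOpen_set_pi Set.finite_univ fun w _ => hVo w).preimage (skewPiEquiv F E c N J hc hfix).continuous
  have hV0' : (0 : archSkew F E c N J) ∈ skewPiEquiv F E c N J hc hfix ⁻¹' Set.pi Set.univ V := by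
    rw [Set.mem_preimage, map_zero]
    exact fun w _ => hV0 w
  have hK' : IsCompact (skewPiEquiv F E c N J hc hfix ⁻¹' Set.pi Set.univ K) := by
    rw [← ContinuousLinearEquiv.image_symm_eq_preimage]
    exact (isCompact_univ_pi fun w => hK w).image (skewPiEquiv F E c N J hc hfix).symm.continuous
  have hKs' : skewPiEquiv F E c N J hc hfix ⁻¹' Set.pi Set.univ K ⊆ cayleySource F E c N J :=
    fun X hX => (mem_cayleySource_iff_forall hc hfix X).2 fun w => hKs w (hX w (Set.mem_univ w))
  have hVK' : skewPiEquiv F E c N J hc hfix ⁻¹' Set.pi Set.univ V ⊆ skewPiEquiv F E c N J hc hfix ⁻¹' Set.pi Set.univ K :=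
    Set.preimage_mono (Set.pi_mono fun w _ => hVK w)
  exact archTopFormHaar_restrict_image_of_isOpen J hnd hVo' hV0' hK' hKs' hVK'

/-! ## §2 The slice: the local any-window identity at one place -/

/-- **THE LOCAL ANY-WINDOW IDENTITY, `_of` form**: for `J` with the product data (E1) `hlam`, (E2) `hweight`, `hnd`, `hndw` (★ U2 `map_archPiEquiv_archTopFormHaar_of`'s
hypotheses), a complex place `w₀` and an admissible `V ⊆ 𝔲(σ_{w₀} J)` (open, `∋ 0`, `V ⊆ K ⊆ source`, `K` compact):
`(localTopFormHaar N (σ_{w₀} J))|_{ĉ(V)} = ĉ_*(w₀ · lieStdLebesgueC|_V)` — the slice of ★ (P0) through the product theorem.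
[cite: Helgason2000, Ch. I §1 Thm. 1.14 (13) p. 96] [cite: Rogawski1990, §1.7 p. 6] -/
theorem localTopFormHaar_restrict_image_of_isOpen_of (hc : c ≠ 1) (hfix : ∀ w : InfinitePlace E, c • w = w) (hnd : lieGramDet F E c N J ≠ 0)
    (hndw : ∀ w : {w : InfinitePlace E // IsComplex w}, lieGramDetC N (J.map w.1.embedding) ≠ 0)
    (hlam : (lieStdLebesgue F E c N J).map (skewPiEquiv F E c N J hc hfix) =
      Measure.pi fun w : {w : InfinitePlace E // IsComplex w} => lieStdLebesgueC N (J.map w.1.embedding))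
    (hweight : ∀ X : archSkew F E c N J,
      cayleyWeight F E c N J X = ∏ w : {w : InfinitePlace E // IsComplex w}, cayleyWeightC N (J.map w.1.embedding) (skewPiEquiv F E c N J hc hfix X w))
    (w₀ : {w : InfinitePlace E // IsComplex w}) {V K : Set ↥(skewC N (J.map w₀.1.embedding))}
    (hVo : IsOpen V) (h0 : (0 : ↥(skewC N (J.map w₀.1.embedding))) ∈ V) (hK : IsCompact K) (hKs : K ⊆ cayleySourceC N (J.map w₀.1.embedding)) (hVK : V ⊆ K) :
    (localTopFormHaar N (J.map w₀.1.embedding)).restrict (cayleyChartC N (J.map w₀.1.embedding) '' V) =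
      cayleyChartMeasureC N (J.map w₀.1.embedding) (lieStdLebesgueC N (J.map w₀.1.embedding)) V := by
  haveI : ∀ w : {w : InfinitePlace E // IsComplex w}, LocallyCompactSpace ↥(unitaryGroupOfForm (starRingEnd ℂ) (J.map w.1.embedding)) := fun w =>
    locallyCompactSpace_unitaryGroupOfForm_complex (n := Fin N) (J.map w.1.embedding)
  haveI : ∀ w : {w : InfinitePlace E // IsComplex w}, SecondCountableTopology ↥(unitaryGroupOfForm (starRingEnd ℂ) (J.map w.1.embedding)) := fun w =>
    secondCountableTopology_unitaryGroupOfForm_complex (n := Fin N) (J.map w.1.embedding)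
  haveI : ∀ w : {w : InfinitePlace E // IsComplex w}, LocallyCompactSpace (archLocal E N J w) := fun w =>
    locallyCompactSpace_unitaryGroupOfForm_complex (n := Fin N) (J.map w.1.embedding)
  haveI : ∀ w : {w : InfinitePlace E // IsComplex w}, SecondCountableTopology (archLocal E N J w) := fun w =>
    secondCountableTopology_unitaryGroupOfForm_complex (n := Fin N) (J.map w.1.embedding)
  haveI : ∀ w : {w : InfinitePlace E // IsComplex w}, (localTopFormHaar N (J.map w.1.embedding)).IsHaarMeasure := fun w =>
    isHaarMeasure_localTopFormHaar (hndw w)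
  haveI : ∀ w : {w : InfinitePlace E // IsComplex w}, (lieStdLebesgueC N (J.map w.1.embedding)).IsAddHaarMeasure := fun w =>
    isAddHaarMeasure_lieStdLebesgueC (hndw w)
  haveI : BorelSpace (∀ w : {w : InfinitePlace E // IsComplex w}, ↥(unitaryGroupOfForm (starRingEnd ℂ) (J.map w.1.embedding))) := Pi.borelSpace
  haveI : BorelSpace (∀ w : {w : InfinitePlace E // IsComplex w}, archLocal E N J w) := Pi.borelSpace
  have hVs : V ⊆ cayleySourceC N (J.map w₀.1.embedding) := hVK.trans hKs
  have hIo : IsOpen (cayleyChartC N (J.map w₀.1.embedding) '' V) := isOpen_image_cayleyChartC hVs hVo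
  refine Measure.ext fun S hS => ?_
  rw [Measure.restrict_apply hS, cayleyChartMeasureC_apply _ _ hS]
  set A₀ : Set ↥(skewC N (J.map w₀.1.embedding)) := cayleyChartC N (J.map w₀.1.embedding) ⁻¹' S ∩ V with hA₀
  have hA₀m : MeasurableSet A₀ := (measurable_cayleyChartC hS).inter hVo.measurableSet
  have hA₀V : A₀ ⊆ V := Set.inter_subset_right
  have hSA : S ∩ cayleyChartC N (J.map w₀.1.embedding) '' V = cayleyChartC N (J.map w₀.1.embedding) '' A₀ := by rw [hA₀, Set.image_preimage_inter]
  rw [hSA]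
  -- the one-place families: `A` (measurable), `V'` ∕ `K'` (admissible product window), windows of record off `w₀`
  let W : ∀ w : {w : InfinitePlace E // IsComplex w}, Set ↥(skewC N (J.map w.1.embedding)) := fun w => windowC N (J.map w.1.embedding)
  let A : ∀ w : {w : InfinitePlace E // IsComplex w}, Set ↥(skewC N (J.map w.1.embedding)) := Function.update W w₀ A₀
  let V' : ∀ w : {w : InfinitePlace E // IsComplex w}, Set ↥(skewC N (J.map w.1.embedding)) := Function.update W w₀ V
  let K' : ∀ w : {w : InfinitePlace E // IsComplex w}, Set ↥(skewC N (J.map w.1.embedding)) :=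
    Function.update (fun w => Metric.closedBall (0 : ↥(skewC N (J.map w.1.embedding))) (windowRadiusC N (J.map w.1.embedding))) w₀ K
  have hA₀' : A w₀ = A₀ := Function.update_self _ _ _
  have hAW : ∀ w : {w : InfinitePlace E // IsComplex w}, w ≠ w₀ → A w = windowC N (J.map w.1.embedding) := fun w hw => Function.update_of_ne hw _ _
  have hV'₀ : V' w₀ = V := Function.update_self _ _ _
  have hV'W : ∀ w : {w : InfinitePlace E // IsComplex w}, w ≠ w₀ → V' w = windowC N (J.map w.1.embedding) := fun w hw => Function.update_of_ne hw _ _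
  have hK'₀ : K' w₀ = K := Function.update_self _ _ _
  have hK'W : ∀ w : {w : InfinitePlace E // IsComplex w}, w ≠ w₀ → K' w = Metric.closedBall (0 : ↥(skewC N (J.map w.1.embedding))) (windowRadiusC N (J.map w.1.embedding)) :=
    fun w hw => Function.update_of_ne hw _ _
  have hV'o : ∀ w : {w : InfinitePlace E // IsComplex w}, IsOpen (V' w) := by
    intro w; rcases eq_or_ne w w₀ with rfl | hw
    · rw [hV'₀]; exact hVo
    · rw [hV'W w hw]; exact isOpen_windowC
  have hV'0 : ∀ w : {w : InfinitePlace E // IsComplex w}, (0 : ↥(skewC N (J.map w.1.embedding))) ∈ V' w := by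
    intro w; rcases eq_or_ne w w₀ with rfl | hw
    · rw [hV'₀]; exact h0
    · rw [hV'W w hw]; exact zero_mem_windowC
  have hK'c : ∀ w : {w : InfinitePlace E // IsComplex w}, IsCompact (K' w) := by
    haveI : FiniteDimensional ℝ (Matrix (Fin N) (Fin N) ℂ) := finiteDimensional_matrixC
    intro w; rcases eq_or_ne w w₀ with rfl | hw
    · rw [hK'₀]; exact hK
    · rw [hK'W w hw]; exact isCompact_closedBall _ _
  have hK's : ∀ w : {w : InfinitePlace E // IsComplex w}, K' w ⊆ cayleySourceC N (J.map w.1.embedding) := by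
    intro w; rcases eq_or_ne w w₀ with rfl | hw
    · rw [hK'₀]; exact hKs
    · rw [hK'W w hw]; exact closedBall_windowRadiusC_subset
  have hV'K' : ∀ w : {w : InfinitePlace E // IsComplex w}, V' w ⊆ K' w := by
    intro w; rcases eq_or_ne w w₀ with rfl | hw
    · rw [hV'₀, hK'₀]; exact hVK
    · rw [hV'W w hw, hK'W w hw]; exact Metric.ball_subset_closedBall
  have hAV' : ∀ w : {w : InfinitePlace E // IsComplex w}, A w ⊆ V' w := by
    intro w; rcases eq_or_ne w w₀ with rfl | hw
    · rw [hA₀', hV'₀]; exact hA₀V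
    · rw [hAW w hw, hV'W w hw]
  have hAs : ∀ w : {w : InfinitePlace E // IsComplex w}, A w ⊆ cayleySourceC N (J.map w.1.embedding) := fun w => ((hAV' w).trans (hV'K' w)).trans (hK's w)
  have hAi : ∀ w : {w : InfinitePlace E // IsComplex w}, IntegrableOn (cayleyWeightC N (J.map w.1.embedding)) (A w) (lieStdLebesgueC N (J.map w.1.embedding)) := fun w =>
    integrableOn_cayleyWeightC_of_subset_isCompact w _ (hK'c w) (hK's w) ((hAV' w).trans (hV'K' w))
  have hAim : ∀ w : {w : InfinitePlace E // IsComplex w}, MeasurableSet (cayleyChartC N (J.map w.1.embedding) '' A w) := by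
    intro w; rcases eq_or_ne w w₀ with rfl | hw
    · rw [hA₀', ← hSA]; exact hS.inter hIo.measurableSet
    · rw [hAW w hw]; exact isOpen_image_windowC.measurableSet
  -- (1) the box `Π_w ĉ_w(A_w)` read through `archPiEquiv`: it is `ĉ(skewPiEquiv⁻¹(Π_w A_w))`, inside the chart image of the product window `Π_w V'_w`
  have hbox : MeasurableSet (Set.pi Set.univ (fun w => cayleyChartC N (J.map w.1.embedding) '' A w) :
      Set (∀ w : {w : InfinitePlace E // IsComplex w}, archLocal E N J w)) := MeasurableSet.univ_pi hAim
  have hem : Measurable (archPiEquiv F E c N J hc hfix) := (archPiEquiv F E c N J hc hfix).continuous.measurable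
  have hT : archPiEquiv F E c N J hc hfix ⁻¹' (Set.pi Set.univ fun w => cayleyChartC N (J.map w.1.embedding) '' A w) =
      cayleyChart F E c N J '' (skewPiEquiv F E c N J hc hfix ⁻¹' Set.pi Set.univ A) := archPiEquiv_preimage_pi_image_cayleyChartC hc hfix A hAs
  have h𝒱s : skewPiEquiv F E c N J hc hfix ⁻¹' Set.pi Set.univ V' ⊆ cayleySource F E c N J :=
    fun X hX => (mem_cayleySource_iff_forall hc hfix X).2 fun w => (hV'K' w).trans (hK's w) (hX w (Set.mem_univ w))
  have hTsub : archPiEquiv F E c N J hc hfix ⁻¹' (Set.pi Set.univ fun w => cayleyChartC N (J.map w.1.embedding) '' A w) ⊆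
      cayleyChart F E c N J '' (skewPiEquiv F E c N J hc hfix ⁻¹' Set.pi Set.univ V') := by
    rw [hT]; exact Set.image_mono (Set.preimage_mono (Set.pi_mono fun w _ => hAV' w))
  have hpre : cayleyChart F E c N J ⁻¹' (cayleyChart F E c N J '' (skewPiEquiv F E c N J hc hfix ⁻¹' Set.pi Set.univ A)) ∩
      (skewPiEquiv F E c N J hc hfix ⁻¹' Set.pi Set.univ V') = skewPiEquiv F E c N J hc hfix ⁻¹' Set.pi Set.univ A := by
    ext X
    constructor
    · rintro ⟨⟨Y, hY, hYX⟩, hXV⟩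
      have hYs : Y ∈ cayleySource F E c N J := h𝒱s (Set.preimage_mono (Set.pi_mono fun w _ => hAV' w) hY)
      rw [injOn_cayleyChart J hYs (h𝒱s hXV) hYX] at hY
      exact hY
    · intro hX
      exact ⟨⟨X, hX, rfl⟩, Set.preimage_mono (Set.pi_mono fun w _ => hAV' w) hX⟩
  -- (2) `(archPiEquiv)_* μ^TF` of the box, two ways: ★ (P0) on the product window + Fubini, and the product theorem + `Measure.pi_pi`
  have hmapped : ((archTopFormHaar F E c N J).map (archPiEquiv F E c N J hc hfix)) (Set.pi Set.univ fun w => cayleyChartC N (J.map w.1.embedding) '' A w) =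
      ∏ w : {w : InfinitePlace E // IsComplex w}, ∫⁻ X in A w, ENNReal.ofReal (cayleyWeightC N (J.map w.1.embedding) X) ∂lieStdLebesgueC N (J.map w.1.embedding) := by
    rw [Measure.map_apply hem hbox, ← Set.inter_eq_left.2 hTsub, ← Measure.restrict_apply (hem hbox),
      archTopFormHaar_restrict_image_preimage_pi hc hfix hnd V' K' hV'o hV'0 hK'c hK's hV'K', cayleyChartMeasure_apply J _ _ (hem hbox), hT, hpre]
    exact lintegral_cayleyWeight_preimage_pi hc hfix hndw hlam hweight A hAi
  have hprodthm := congrArg (fun m : Measure (∀ w : {w : InfinitePlace E // IsComplex w}, archLocal E N J w) =>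
      m (Set.pi Set.univ fun w => cayleyChartC N (J.map w.1.embedding) '' A w)) (map_archPiEquiv_archTopFormHaar_of hc hfix hnd hndw hlam hweight)
  have hpi : (Measure.pi fun w : {w : InfinitePlace E // IsComplex w} => (localTopFormHaar N (J.map w.1.embedding) : Measure (archLocal E N J w)))
      (Set.pi Set.univ fun w => cayleyChartC N (J.map w.1.embedding) '' A w) =
      ∏ w : {w : InfinitePlace E // IsComplex w}, localTopFormHaar N (J.map w.1.embedding) (cayleyChartC N (J.map w.1.embedding) '' A w) := Measure.pi_pi _ _
  -- (3) split off the place `w₀`; off `w₀` both sides are the window masses of record, finite and non-zero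
  have hrest : ∏ w ∈ Finset.univ \ {w₀}, localTopFormHaar N (J.map w.1.embedding) (cayleyChartC N (J.map w.1.embedding) '' A w) =
      ∏ w ∈ Finset.univ \ {w₀}, ∫⁻ X in A w, ENNReal.ofReal (cayleyWeightC N (J.map w.1.embedding) X) ∂lieStdLebesgueC N (J.map w.1.embedding) := by
    refine Finset.prod_congr rfl fun w hw => ?_
    have hw' : w ≠ w₀ := by simpa using hw
    rw [hAW w hw']
    exact localTopFormHaar_image_windowC_eq_lintegral (J.map w.1.embedding)
  have hrest_ne : ∏ w ∈ Finset.univ \ {w₀}, localTopFormHaar N (J.map w.1.embedding) (cayleyChartC N (J.map w.1.embedding) '' A w) ≠ 0 ∧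
      ∏ w ∈ Finset.univ \ {w₀}, localTopFormHaar N (J.map w.1.embedding) (cayleyChartC N (J.map w.1.embedding) '' A w) ≠ ⊤ := by
    refine ⟨Finset.prod_ne_zero_iff.2 fun w hw => ?_, ENNReal.prod_ne_top fun w hw => ?_⟩
    · have hw' : w ≠ w₀ := by simpa using hw
      rw [hAW w hw']; exact haar_image_windowC_ne_zero _
    · have hw' : w ≠ w₀ := by simpa using hw
      rw [hAW w hw']; exact haar_image_windowC_ne_top _
  have key := hpi.symm.trans (hprodthm.symm.trans hmapped)
  rw [Finset.prod_eq_mul_prod_sdiff_singleton_of_mem (Finset.mem_univ w₀)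
      (fun w : {w : InfinitePlace E // IsComplex w} => localTopFormHaar N (J.map w.1.embedding) (cayleyChartC N (J.map w.1.embedding) '' A w)),
    Finset.prod_eq_mul_prod_sdiff_singleton_of_mem (Finset.mem_univ w₀)
      (fun w : {w : InfinitePlace E // IsComplex w} => ∫⁻ X in A w, ENNReal.ofReal (cayleyWeightC N (J.map w.1.embedding) X) ∂lieStdLebesgueC N (J.map w.1.embedding)),
    ← hrest, hA₀'] at key
  exact (ENNReal.mul_left_inj hrest_ne.1 hrest_ne.2).1 key

/-- **THE LOCAL ANY-WINDOW IDENTITY** for a `c`-hermitian `J` with `det J` a unit and `c ≠ 1` fixing every infinite place: at every complex place `w₀` and every admissible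
`V ⊆ 𝔲(σ_{w₀} J)`, `(localTopFormHaar N (σ_{w₀} J))|_{ĉ(V)} = ĉ_*(w₀ · lieStdLebesgueC|_V)` ((E1), (E2), `hnd`, `hndw` discharged by ★ FILE E and ★ `lieGramDet_ne_zero`).
[cite: Helgason2000, Ch. I §1 Thm. 1.14 (13) p. 96] [cite: Rogawski1990, §1.7 p. 6] -/
theorem localTopFormHaar_restrict_image_of_isOpen (hc : c ≠ 1) (hfix : ∀ w : InfinitePlace E, c • w = w) (hherm : (J.map c)ᵀ = J) (hJ : IsUnit J.det)
    (w₀ : {w : InfinitePlace E // IsComplex w}) {V K : Set ↥(skewC N (J.map w₀.1.embedding))}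
    (hVo : IsOpen V) (h0 : (0 : ↥(skewC N (J.map w₀.1.embedding))) ∈ V) (hK : IsCompact K) (hKs : K ⊆ cayleySourceC N (J.map w₀.1.embedding)) (hVK : V ⊆ K) :
    (localTopFormHaar N (J.map w₀.1.embedding)).restrict (cayleyChartC N (J.map w₀.1.embedding) '' V) =
      cayleyChartMeasureC N (J.map w₀.1.embedding) (lieStdLebesgueC N (J.map w₀.1.embedding)) V := by
  have hnd : lieGramDet F E c N J ≠ 0 := lieGramDet_ne_zero J hc hfix hherm hJ
  have htr := traceForm_eq_sum_traceFormC (J := J) hc hfix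
  exact localTopFormHaar_restrict_image_of_isOpen_of hc hfix hnd
    (fun w => lieGramDetC_ne_zero_of_lieGramDet_ne_zero (skewPiEquiv F E c N J hc hfix) htr hnd w)
    (map_lieStdLebesgue_eq_pi (skewPiEquiv F E c N J hc hfix) htr)
    (cayleyWeight_eq_prod (skewPiEquiv F E c N J hc hfix) fun X Y w => skewPiEquiv_skewMulL hc hfix X Y w) w₀ hVo h0 hK hKs hVK

end Generic

end UnitaryArchTopForm

/-! ## §3 The CM reading: `archLocalTopFormHaar L N H w` on any admissible window, and its total mass -/

namespace UnitaryArchLocalTopForm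

open Literature.NumberTheory.Automorphic Literature.NumberTheory.Automorphic.UnitaryGroup Literature.NumberTheory.Weil1964.UnitaryArchTopForm

section CM

variable (L : Type) [Field L] [NumberField L] [IsCMField L] (N : ℕ) (H : Matrix (Fin N) (Fin N) L)

/-- **THE LOCAL ANY-WINDOW IDENTITY, CM reading**: for `H` `c`-hermitian with `det H` a unit over the CM field `L`, a complex place `w`, and an admissible `V ⊆ 𝔲(σ_w H)`
(open, `∋ 0`, `V ⊆ K ⊆ source`, `K` compact): `(archLocalTopFormHaar L N H w)|_{ĉ_w(V)} = ĉ_{w*}(w₀,w · lieStdLebesgueC|_V)` — ★ (P0) `archTopFormHaar_restrict_image_of_isOpen`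
read at ONE place (slice through ★ U2 `map_archPiEquivCM_archTopFormHaar`). [cite: Helgason2000, Ch. I §1 Thm. 1.14 (13) p. 96] [cite: Rogawski1990, §1.7 p. 6] -/
theorem archLocalTopFormHaar_restrict_image_of_isOpen (hherm : (H.map (IsCMField.complexConj L))ᵀ = H) (hdet : IsUnit H.det)
    (w : {w : InfinitePlace L // IsComplex w}) [MeasurableSpace (GL (Fin N) ℂ)] [BorelSpace (GL (Fin N) ℂ)]
    [iM : MeasurableSpace ↥(skewC N (H.map w.1.embedding))] [BorelSpace ↥(skewC N (H.map w.1.embedding))]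
    {V K : Set ↥(skewC N (H.map w.1.embedding))} (hVo : IsOpen V) (h0 : (0 : ↥(skewC N (H.map w.1.embedding))) ∈ V) (hK : IsCompact K)
    (hKs : K ⊆ cayleySourceC N (H.map w.1.embedding)) (hVK : V ⊆ K) :
    (archLocalTopFormHaar L N H w).restrict (cayleyChartC N (H.map w.1.embedding) '' V) =
      cayleyChartMeasureC N (H.map w.1.embedding) (lieStdLebesgueC N (H.map w.1.embedding)) V := by
  have hiM : iM = borel _ := BorelSpace.measurable_eq
  subst hiM
  letI : ∀ w' : {w : InfinitePlace L // IsComplex w}, MeasurableSpace ↥(skewC N (H.map w'.1.embedding)) := fun w' => borel _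
  haveI : ∀ w' : {w : InfinitePlace L // IsComplex w}, BorelSpace ↥(skewC N (H.map w'.1.embedding)) := fun w' => ⟨rfl⟩
  letI : MeasurableSpace (archSkew (↥(maximalRealSubfield L)) L (IsCMField.complexConj L) N H) := borel _
  haveI : BorelSpace (archSkew (↥(maximalRealSubfield L)) L (IsCMField.complexConj L) N H) := ⟨rfl⟩
  letI : MeasurableSpace (arch (↥(maximalRealSubfield L)) L (IsCMField.complexConj L) N H) := borel _
  haveI : BorelSpace (arch (↥(maximalRealSubfield L)) L (IsCMField.complexConj L) N H) := ⟨rfl⟩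
  exact localTopFormHaar_restrict_image_of_isOpen (IsCMField.complexConj_ne_one L) (complexConj_smul_infinitePlace L) hherm hdet w hVo h0 hK hKs hVK

/-- The total-mass form of the local any-window identity: `μ^TF_w(ĉ_w(V)) = ∫_V w₀,w dλ_w` for admissible `V`. [cite: Helgason2000, Ch. I §1 Thm. 1.14 (13) p. 96] -/
theorem archLocalTopFormHaar_image_eq_lintegral (hherm : (H.map (IsCMField.complexConj L))ᵀ = H) (hdet : IsUnit H.det)
    (w : {w : InfinitePlace L // IsComplex w}) [MeasurableSpace (GL (Fin N) ℂ)] [BorelSpace (GL (Fin N) ℂ)]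
    [MeasurableSpace ↥(skewC N (H.map w.1.embedding))] [BorelSpace ↥(skewC N (H.map w.1.embedding))]
    {V K : Set ↥(skewC N (H.map w.1.embedding))} (hVo : IsOpen V) (h0 : (0 : ↥(skewC N (H.map w.1.embedding))) ∈ V) (hK : IsCompact K)
    (hKs : K ⊆ cayleySourceC N (H.map w.1.embedding)) (hVK : V ⊆ K) :
    archLocalTopFormHaar L N H w (cayleyChartC N (H.map w.1.embedding) '' V) =
      ∫⁻ X in V, ENNReal.ofReal (cayleyWeightC N (H.map w.1.embedding) X) ∂lieStdLebesgueC N (H.map w.1.embedding) :=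
  measure_image_eq_lintegral_of_restrict_eq (archLocalTopFormHaar L N H w) _ hVo (hVK.trans hKs)
    (archLocalTopFormHaar_restrict_image_of_isOpen L N H hherm hdet w hVo h0 hK hKs hVK)

/-- Non-degeneracy of the one-place trace form at every complex place, from the global hypotheses (★ FILE E (E3) over ★ `lieGramDet_ne_zero`). [cite: Rogawski1990, §1.7 p. 6] -/
theorem lieGramDetC_map_embedding_ne_zero (hherm : (H.map (IsCMField.complexConj L))ᵀ = H) (hdet : IsUnit H.det) (w : {w : InfinitePlace L // IsComplex w}) :
    lieGramDetC N (H.map w.1.embedding) ≠ 0 :=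
  lieGramDetC_ne_zero_of_lieGramDet_ne_zero (skewPiEquiv _ L (IsCMField.complexConj L) N H (IsCMField.complexConj_ne_one L) (complexConj_smul_infinitePlace L))
    (traceForm_eq_sum_traceFormC (J := H) (IsCMField.complexConj_ne_one L) (complexConj_smul_infinitePlace L))
    (lieGramDet_ne_zero H (IsCMField.complexConj_ne_one L) (complexConj_smul_infinitePlace L) hherm hdet) w

/-- **THE TOTAL MASS OF `μ^TF_w`**: `archLocalTopFormHaar L N H w (univ) = ∫_{𝔲(σ_w H)} w₀,w dλ_w` — the local any-window identity fed to FILE 2's exhaustion and FILE 1's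
null complement.  (The value of the integral — `π` for `N = 1`, the `U(2)`-integral for `N = 2` — is A-p12 (g20)'s (b3)-(iii).) [cite: Helgason2000, Ch. I §1 Thm. 1.14 p. 96]
[cite: Rogawski1990, §1.7 p. 6] [cite: Weyl1939, Ch. II §10] -/
theorem archLocalTopFormHaar_univ_eq_lintegral (hherm : (H.map (IsCMField.complexConj L))ᵀ = H) (hdet : IsUnit H.det)
    (w : {w : InfinitePlace L // IsComplex w}) [MeasurableSpace (GL (Fin N) ℂ)] [BorelSpace (GL (Fin N) ℂ)]
    [MeasurableSpace ↥(skewC N (H.map w.1.embedding))] [BorelSpace ↥(skewC N (H.map w.1.embedding))] :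
    archLocalTopFormHaar L N H w Set.univ = ∫⁻ X, ENNReal.ofReal (cayleyWeightC N (H.map w.1.embedding) X) ∂lieStdLebesgueC N (H.map w.1.embedding) := by
  have hnd := lieGramDetC_map_embedding_ne_zero L N H hherm hdet w
  haveI : LocallyCompactSpace ↥(unitaryGroupOfForm (starRingEnd ℂ) (H.map w.1.embedding)) := locallyCompactSpace_unitaryGroupOfForm_complex (n := Fin N) _
  haveI : SecondCountableTopology ↥(unitaryGroupOfForm (starRingEnd ℂ) (H.map w.1.embedding)) := secondCountableTopology_unitaryGroupOfForm_complex (n := Fin N) _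
  haveI : (localTopFormHaar N (H.map w.1.embedding)).IsHaarMeasure := isHaarMeasure_localTopFormHaar hnd
  haveI := isAddHaarMeasure_lieStdLebesgueC (N := N) (Jw := H.map w.1.embedding) hnd
  exact measure_univ_eq_lintegral_cayleyWeightC_of_window (localTopFormHaar N (H.map w.1.embedding)) (lieStdLebesgueC N (H.map w.1.embedding))
    fun V K hVo h0 hK hKs hVK => archLocalTopFormHaar_image_eq_lintegral L N H hherm hdet w hVo h0 hK hKs hVK

/-- The same with the integral over the chart source `{1 ± X invertible}`. [cite: Helgason2000, Ch. I §1 Thm. 1.14 p. 96] -/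
theorem archLocalTopFormHaar_univ_eq_setLIntegral (hherm : (H.map (IsCMField.complexConj L))ᵀ = H) (hdet : IsUnit H.det)
    (w : {w : InfinitePlace L // IsComplex w}) [MeasurableSpace (GL (Fin N) ℂ)] [BorelSpace (GL (Fin N) ℂ)]
    [MeasurableSpace ↥(skewC N (H.map w.1.embedding))] [BorelSpace ↥(skewC N (H.map w.1.embedding))] :
    archLocalTopFormHaar L N H w Set.univ =
      ∫⁻ X in cayleySourceC N (H.map w.1.embedding), ENNReal.ofReal (cayleyWeightC N (H.map w.1.embedding) X) ∂lieStdLebesgueC N (H.map w.1.embedding) := by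
  have hnd := lieGramDetC_map_embedding_ne_zero L N H hherm hdet w
  haveI := isAddHaarMeasure_lieStdLebesgueC (N := N) (Jw := H.map w.1.embedding) hnd
  rw [archLocalTopFormHaar_univ_eq_lintegral L N H hherm hdet w, setLIntegral_cayleySourceC_eq]

/-- A real non-zero diagonal carrier over the CM field `L` is `c`-hermitian with unit determinant (the hypotheses of ★ U2 ∕ of the slice). [cite: Rogawski1990, §1.7 p. 6] -/
theorem diagonal_map_complexConj_transpose_and_isUnit_det (b : Fin N → L) (hb : ∀ i, b i ≠ 0) (hbr : ∀ i, (IsCMField.complexConj L (b i) : L) = b i) :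
    ((Matrix.diagonal b).map (IsCMField.complexConj L))ᵀ = Matrix.diagonal b ∧ IsUnit (Matrix.diagonal b).det := by
  refine ⟨?_, ?_⟩
  · rw [Matrix.diagonal_map (map_zero _), Matrix.diagonal_transpose]
    congr 1; funext i; exact hbr i
  · rw [Matrix.det_diagonal, isUnit_iff_ne_zero]
    exact Finset.prod_ne_zero_iff.2 fun i _ => hb i

/-- **(ii) AT REAL DIAGONAL CARRIERS — the (U)-road junction's `hii` BY NAME**: for a complex place `w` and a real non-zero diagonal carrier `b : Fin N → L`,
`archLocalTopFormHaar L N (diagonal b) w (univ) = ∫⁻_{source} w₀ dλ` over `𝔲(σ_w diag b)` — ★ A-p19 (g24) `blockMass_two∕one_of_massEqSource` ∕ `archTopFormWallCompatible_of_massEqSource_of_clause`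
read `hii := fun w b hb hbr _ _ _ _ => archLocalTopFormHaar_diagonal_univ_eq_setLIntegral L N w b hb hbr` at `N = 2, 1`. [cite: Rogawski1990, §1.7 p. 6] [cite: Helgason2000, Ch. I §1 Thm. 1.14 p. 96] -/
theorem archLocalTopFormHaar_diagonal_univ_eq_setLIntegral (w : {w : InfinitePlace L // IsComplex w}) (b : Fin N → L) (hb : ∀ i, b i ≠ 0)
    (hbr : ∀ i, (IsCMField.complexConj L (b i) : L) = b i) [MeasurableSpace (GL (Fin N) ℂ)] [BorelSpace (GL (Fin N) ℂ)]
    [MeasurableSpace ↥(skewC N ((Matrix.diagonal b).map w.1.embedding))] [BorelSpace ↥(skewC N ((Matrix.diagonal b).map w.1.embedding))] :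
    archLocalTopFormHaar L N (Matrix.diagonal b) w Set.univ =
      ∫⁻ X in cayleySourceC N ((Matrix.diagonal b).map w.1.embedding), ENNReal.ofReal (cayleyWeightC N ((Matrix.diagonal b).map w.1.embedding) X)
        ∂(lieStdLebesgueC N ((Matrix.diagonal b).map w.1.embedding)) :=
  archLocalTopFormHaar_univ_eq_setLIntegral L N (Matrix.diagonal b) (diagonal_map_complexConj_transpose_and_isUnit_det L N b hb hbr).1
    (diagonal_map_complexConj_transpose_and_isUnit_det L N b hb hbr).2 w

/-- The same with the integral over all of `𝔲(σ_w diag b)` (the shape of ★ A-p12 (g20) `lintegral_cayleyWeightC_one`). [cite: Rogawski1990, §1.7 p. 6] [cite: Helgason2000, Ch. I §1 Thm. 1.14 p. 96] -/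
theorem archLocalTopFormHaar_diagonal_univ_eq_lintegral (w : {w : InfinitePlace L // IsComplex w}) (b : Fin N → L) (hb : ∀ i, b i ≠ 0)
    (hbr : ∀ i, (IsCMField.complexConj L (b i) : L) = b i) [MeasurableSpace (GL (Fin N) ℂ)] [BorelSpace (GL (Fin N) ℂ)]
    [MeasurableSpace ↥(skewC N ((Matrix.diagonal b).map w.1.embedding))] [BorelSpace ↥(skewC N ((Matrix.diagonal b).map w.1.embedding))] :
    archLocalTopFormHaar L N (Matrix.diagonal b) w Set.univ =
      ∫⁻ X, ENNReal.ofReal (cayleyWeightC N ((Matrix.diagonal b).map w.1.embedding) X) ∂(lieStdLebesgueC N ((Matrix.diagonal b).map w.1.embedding)) :=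
  archLocalTopFormHaar_univ_eq_lintegral L N (Matrix.diagonal b) (diagonal_map_complexConj_transpose_and_isUnit_det L N b hb hbr).1
    (diagonal_map_complexConj_transpose_and_isUnit_det L N b hb hbr).2 w

end CM

end UnitaryArchLocalTopForm

end Literature.NumberTheory.Weil1964

end
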